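import Literature.AlgebraicGeometry.Kloosterman2025.LinearSectionInstances
import Literature.AlgebraicGeometry.Kloosterman2025.TwoPlanesNormalForm
import Literature.RingTheory.MvPolynomial.IdealDegreeSemicontinuity
import HarnessLib

/-!
# Kloosterman 2025, Prop. 6.4 / Remark 6.7: the Hilbert function of `I^{(t)}` for GENERAL linear forms
# (`k = 2, 3, 4`: cubic four/six/eightfolds — the census cells `(4,3,−1)`, `(6,3,0)`, `(8,3,1)`)

R. Kloosterman, *On a conjecture on Hodge loci of linear combinations of linear subvarieties*, Rend. Circ. Mat.
Palermo (2) 74 (2025) = arXiv:2312.12363, §6 [cite: Kloosterman2025, Prop. 6.4 (proof), Remark 6.7]: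

> […] one easily checks that the Hilbert functions of `I^{(0)}` and of `I^{(t)}` coincide. Hence the family is flat […]

Here `I^{(t)} = (p₁, …, p₅)` is the ideal of the five substituted Plücker quadrics attached to a cubic `2k`-fold
`X = V(Σ_{i≤2<j} x_i x_j L_{ij})` containing the two `k`-planes, the `L_{ij}` being linear forms. The tree proves the
Hilbert function of `I^{(t)} + (x_{k+4}, …, x_{2k+1})` for EVERY `k ≥ 2` under one Artinian reduction
(`LinearSectionHilbertFunctions.prop_6_4_hilbert_fibre_of_reduction`: `k + 1` linear forms `y` with
`h_{S/(I^{(t)} + (x_T) + (y))} ≤ (1, 3, 1)`), and `LinearSectionInstances` checks that reduction at ONE rational point for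
`k = 2, 3, 4`. THIS FILE turns the single instance into the statement for GENERAL `L_{ij}` (cell pub-hlocus, honest
framing: certified instances and evidence bearing on the general Hodge conjecture; no claim):

* **`hilbert_pluckerIdeal_general_fibre`** (any ambient `ℙⁿ`, tail `T`, indices): if the reduction `(H)` holds for
  ONE choice of linear forms `L⁰_{ij}`, scalar `u⁰` and linear `y`, then there is a polynomial `δ` in the
  `6(n+1) + 1` coefficients of `(L_{ij}, u)`, NON-ZERO at `(L⁰, u⁰)`, such that for every `(L, u)` with
  `δ(L, u) ≠ 0` the ideal `I^{(t)}(L, u) + (x_T)` has Hilbert function `χ_{r+1} + 3χ_{r+1}(·−1) + χ_{r+1}(·−2)`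
  (`r + 1 = n − 2 − #T`): by the lower semicontinuity of `p ↦ dim_K C(p)_d`, `d = 1, 2, 3`
  (`IdealDegreeSemicontinuity.exists_eval_ne_zero_finrank_idealDegree_le_finset` — one maximal minor of the universal
  coefficient matrix [cite: GortzWedhorn2020, (16.1), eq. (16.1.1)]) the open condition `(H)` propagates from the
  witness to all `(L, u)` off the hypersurface `δ = 0`, with the SAME `y`;
* **`prop_6_4_hilbert_general_fibre_k2 / _k3 / _k4`** — the printed coordinates (`ℙ^{2k+1}`, indices `0,1,2,3`,
  tail `x_{k+4}, …`): `∃ δ ≠ 0` in the coefficients of `(L₀₄, …, L₂₅, u)` with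
  `δ ≠ 0 ⟹ h_{I^{(t)} + (x_T)}(m) = χ_{k+1}(m) + 3χ_{k+1}(m−1) + χ_{k+1}(m−2)` — the value of the central fibre
  `I^{(0)}` (`prop_6_4_hilbert_limit`), i.e. Kloosterman's "the Hilbert functions of `I^{(0)}` and of `I^{(t)}`
  coincide" for the general member of the family, in the census dimensions `k = 2, 3, 4`; the witnesses are the
  rational instances of `LinearSectionInstances`;
* `…_forms` variants of both abstract theorems, stated on arbitrary linear forms `L'` (evaluate `δ` at their
  coefficient table);
* **`hilbert_scrollFibreIdeal_general_fibre`**, **`remark_6_7_hilbert_general_fibre_k2 / _k3`** — the same for the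
  `2 × 2` minors of `A_t` (Remark 6.7; reduction `(1, 3)`, degrees `1, 2`): `χ_{k+1} + 3χ_{k+1}(·−1)`.

"General" is used in the honest algebraic sense: the complement of the hypersurface `δ = 0` in the affine space of
coefficients, non-empty because it contains the rational witness (over any field `K`). NOT formalised: that the
exceptional set is exactly described, flatness over `K[t]`, cycle classes, Cor. 6.5. 0 sorry; no named facts.

## References

* [Kloosterman2025] R. Kloosterman, arXiv:2312.12363 = Rend. Circ. Mat. Palermo (2) 74 (2025), Prop. 6.4 (proof),
  Remark 6.7.
* [GortzWedhorn2020] U. Görtz, T. Wedhorn, *Algebraic Geometry I*, 2nd ed. (2020), (16.1) determinantal varieties.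
* [Stanley1978] R. P. Stanley, *Hilbert functions of graded algebras*, Adv. Math. 28 (1978) 57–83, Cor. 3.2.
-/

noncomputable section

open MvPolynomial Module

namespace Literature.AlgebraicGeometry.Kloosterman2025

open Literature.RingTheory.MvPolynomial Literature.RingTheory.HilbertSamuel

universe u

variable {K : Type u} [Field K]

section LinearForms

variable {N : ℕ}

/-- `Σ vⱼ xⱼ` is a form of degree `1`. [folklore] -/
private theorem isHomogeneous_linForm' (v : Fin N → K) : (linForm v).IsHomogeneous 1 := by
  unfold linForm
  refine IsHomogeneous.sum _ _ _ fun j _ => ?_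
  rw [smul_eq_C_mul]
  simpa using (isHomogeneous_C _ (v j)).mul (isHomogeneous_X K j)

/-- A form of degree `1` is `Σⱼ (coefficient of xⱼ) · xⱼ`. [folklore] -/
private theorem linForm_coeff_eq {f : MvPolynomial (Fin N) K} (hf : f.IsHomogeneous 1) :
    linForm (fun j => coeff (Finsupp.single j 1) f) = f := by
  classical
  ext d
  simp only [linForm, coeff_sum, coeff_smul, coeff_X, smul_eq_mul, mul_ite, mul_one, mul_zero]
  by_cases hd : ∃ p, Finsupp.single p 1 = d
  · obtain ⟨p, rfl⟩ := hd
    rw [Finset.sum_eq_single p (fun q _ hq => if_neg fun h =>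
      hq (Finsupp.single_left_injective one_ne_zero h)) (fun h => absurd (Finset.mem_univ p) h),
      if_pos rfl]
  · rw [Finset.sum_eq_zero fun p _ => if_neg fun h => hd ⟨p, h⟩]
    refine (hf.coeff_eq_zero fun hdeg => hd ?_).symm
    obtain ⟨p, hp⟩ := (Finsupp.sum_eq_one_iff d).mp hdeg
    exact ⟨p, hp.symm⟩

/-- The universal linear form `Σ_v a_{i,v} x_v` (coefficients = parameter variables) specialises at the
coefficient table `c` to `linForm (c (i, ·))`. [folklore] -/
private theorem map_eval_univLinForm {ι : Type*} (c : Option (ι × Fin N) → K) (i : ι) :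
    MvPolynomial.map (eval c)
        (∑ v : Fin N, C (X (some (i, v)) : MvPolynomial (Option (ι × Fin N)) K) * X v) =
      linForm fun v => c (some (i, v)) := by
  simp only [linForm, map_sum, map_mul, map_C, map_X, eval_X, smul_eq_C_mul]

/-- The universal linear form is homogeneous of degree `1`. [folklore] -/
private theorem isHomogeneous_univLinForm {ι : Type*} (i : ι) :
    (∑ v : Fin N, C (X (some (i, v)) : MvPolynomial (Option (ι × Fin N)) K) * X v).IsHomogeneous 1 := by
  refine IsHomogeneous.sum _ _ _ fun v _ => ?_
  simpa using (isHomogeneous_C _ _).mul (isHomogeneous_X (MvPolynomial (Option (ι × Fin N)) K) v)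

/-- A constant times a variable is a linear form. [folklore] -/
private theorem isHomogeneous_C_mul_X' {R : Type*} [CommSemiring R] (a : R) (v : Fin N) :
    (C a * X v : MvPolynomial (Fin N) R).IsHomogeneous 1 := by
  simpa using (isHomogeneous_C _ a).mul (isHomogeneous_X R v)

/-- Forms lifted along `K → K[P]` specialise back to themselves. [folklore] -/
private theorem map_eval_map_C {P : Type*} (c : P → K) (f : MvPolynomial (Fin N) K) :
    MvPolynomial.map (eval c) (MvPolynomial.map (C : K →+* MvPolynomial P K) f) = f := by
  rw [map_map]
  have h : (eval c).comp (C : K →+* MvPolynomial P K) = RingHom.id K := RingHom.ext fun a => eval_C a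
  rw [h, map_id]

end LinearForms

/-! ## Monotonicity bookkeeping for the reduction hypothesis -/

section Transfer

variable {N : ℕ}

/-- If `C₀ ⊇ S_d` and `dim (C₀)_d ≤ dim C_d` then `C ⊇ S_d`. [folklore] -/
private theorem forall_mem_of_finrank_le {C₀ C : Ideal (MvPolynomial (Fin N) K)} {d : ℕ}
    (h₀ : ∀ f : MvPolynomial (Fin N) K, f.IsHomogeneous d → f ∈ C₀)
    (hle : finrank K (idealDegree C₀ d) ≤ finrank K (idealDegree C d)) :
    ∀ f : MvPolynomial (Fin N) K, f.IsHomogeneous d → f ∈ C := by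
  haveI : Module.Finite K (homogeneousSubmodule (Fin N) K d) :=
    Module.Finite.iff_fg.mpr (homogeneousSubmodule_fg (Fin N) K d)
  have h0 : idealDegree C₀ d = homogeneousSubmodule (Fin N) K d :=
    le_antisymm (idealDegree_le_homogeneousSubmodule C₀ d) fun f hf =>
      ⟨h₀ f ((mem_homogeneousSubmodule _ _).mp hf), hf⟩
  have hC : idealDegree C d = homogeneousSubmodule (Fin N) K d :=
    Submodule.eq_of_le_of_finrank_le (idealDegree_le_homogeneousSubmodule C d) (by rw [← h0]; exact hle)
  intro f hf
  have : f ∈ idealDegree C d := by rw [hC]; exact (mem_homogeneousSubmodule _ _).mpr hf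
  exact this.1

end Transfer

/-! ## Proposition 6.4: general linear forms -/

section Prop64General

variable {n : ℕ}

/-- Ring maps commute with the formation of the substituted Plücker ideal. [folklore] -/
private theorem map_pluckerIdeal {R S : Type*} [CommRing R] [CommRing S] (f : R →+* S)
    (x₀ x₁ x₂ x₃ L₀₄ L₀₅ L₁₄ L₁₅ L₂₄ L₂₅ u : R) :
    (pluckerIdeal x₀ x₁ x₂ x₃ L₀₄ L₀₅ L₁₄ L₁₅ L₂₄ L₂₅ u).map f =
      pluckerIdeal (f x₀) (f x₁) (f x₂) (f x₃) (f L₀₄) (f L₀₅) (f L₁₄) (f L₁₅) (f L₂₄) (f L₂₅) (f u) := by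
  unfold pluckerIdeal
  rw [Ideal.map_span]
  simp only [Set.image_insert_eq, Set.image_singleton, plucker₁, plucker₂, plucker₃, plucker₄, plucker₅, map_add,
    map_sub, map_mul, map_neg]

/-- The substituted Plücker ideal as the span of the range of a `Fin 5`-family. [folklore] -/
private theorem pluckerIdeal_eq_span_range {R : Type*} [CommRing R] (x₀ x₁ x₂ x₃ L₀₄ L₀₅ L₁₄ L₁₅ L₂₄ L₂₅ u : R) :
    pluckerIdeal x₀ x₁ x₂ x₃ L₀₄ L₀₅ L₁₄ L₁₅ L₂₄ L₂₅ u =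
      Ideal.span (Set.range ![plucker₁ x₀ x₁ L₂₄ x₂ (-L₁₄) L₀₄, plucker₂ x₀ x₁ L₂₅ x₂ (-L₁₅) L₀₅,
        plucker₃ x₀ L₂₄ L₂₅ (-L₁₄) (-L₁₅) (u * x₃), plucker₄ x₁ L₂₄ L₂₅ L₀₄ L₀₅ (u * x₃),
        plucker₅ x₂ (-L₁₄) (-L₁₅) L₀₄ L₀₅ (u * x₃)]) := by
  unfold pluckerIdeal
  rw [Matrix.range_cons, Matrix.range_cons, Matrix.range_cons, Matrix.range_cons, Matrix.range_cons,
    Matrix.range_empty, Set.union_empty]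
  simp only [Set.singleton_union]

/-- The five substituted Plücker quadrics are forms of degree `2` when the ten substituted forms are linear.
[folklore] -/
private theorem isHomogeneous_plucker_vec {R : Type*} [CommRing R] {N : ℕ}
    (x₀ x₁ x₂ x₃ L₀₄ L₀₅ L₁₄ L₁₅ L₂₄ L₂₅ u : MvPolynomial (Fin N) R)
    (h₀ : x₀.IsHomogeneous 1) (h₁ : x₁.IsHomogeneous 1) (h₂ : x₂.IsHomogeneous 1)
    (h₃ : (u * x₃).IsHomogeneous 1)
    (h₀₄ : L₀₄.IsHomogeneous 1) (h₀₅ : L₀₅.IsHomogeneous 1) (h₁₄ : L₁₄.IsHomogeneous 1)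
    (h₁₅ : L₁₅.IsHomogeneous 1) (h₂₄ : L₂₄.IsHomogeneous 1) (h₂₅ : L₂₅.IsHomogeneous 1) :
    ∀ j, (![plucker₁ x₀ x₁ L₂₄ x₂ (-L₁₄) L₀₄, plucker₂ x₀ x₁ L₂₅ x₂ (-L₁₅) L₀₅,
        plucker₃ x₀ L₂₄ L₂₅ (-L₁₄) (-L₁₅) (u * x₃), plucker₄ x₁ L₂₄ L₂₅ L₀₄ L₀₅ (u * x₃),
        plucker₅ x₂ (-L₁₄) (-L₁₅) L₀₄ L₀₅ (u * x₃)] j).IsHomogeneous 2 := by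
  intro j
  fin_cases j
  · exact ((h₀.mul h₀₄).sub (h₁.mul h₁₄.neg)).add (h₂₄.mul h₂)
  · exact ((h₀.mul h₀₅).sub (h₁.mul h₁₅.neg)).add (h₂₅.mul h₂)
  · exact ((h₀.mul h₃).sub (h₂₄.mul h₁₅.neg)).add (h₂₅.mul h₁₄.neg)
  · exact ((h₁.mul h₃).sub (h₂₄.mul h₀₅)).add (h₂₅.mul h₀₄)
  · exact ((h₂.mul h₃).sub (h₁₄.neg.mul h₀₅)).add (h₁₅.neg.mul h₀₄)

variable (T : Finset (Fin (n + 1))) (i₀ i₁ i₂ i₃ : Fin (n + 1))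

open Literature.AlgebraicGeometry.Kloosterman2023 in
/-- **Prop. 6.4, general linear forms (abstract coordinates).** Fix the ambient `ℙⁿ`, the tail `T` and the
indices. Suppose the Artinian reduction `(H)` — `H(S/C)(1) ≤ 3`, `H(S/C)(2) ≤ 1`, `C ⊇ S₃` for
`C = I^{(t)}(L⁰, u⁰) + (x_T) + (y)` — holds for ONE choice of linear forms `L⁰ = (L⁰₀₄, …, L⁰₂₅)`, scalar `u⁰`
and `r + 1` linear forms `y` (`#T + (r+1) + 2 = n`). Then there is a polynomial `δ` in the coefficient table
`(a_{i,v})_{i<6, v≤n}, u` of `(L, u)`, non-zero at the table of `(L⁰, u⁰)`, such that for EVERY `(L, u)` with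
`δ(a, u) ≠ 0` the ideal `I^{(t)}(L, u) + (x_T)` — `L_i = Σ_v a_{i,v} x_v` — has Hilbert function
`χ_{r+1}(m) + 3χ_{r+1}(m−1) + χ_{r+1}(m−2)`: lower semicontinuity of `dim_K C_d` (`d = 1,2,3`) in the parameters
[cite: GortzWedhorn2020, (16.1), eq. (16.1.1)] carries `(H)` (with the same `y`) to the complement of `δ = 0`,
where `prop_6_4`'s reduction theorem applies. [cite: Kloosterman2025, Prop. 6.4 (proof)] -/
theorem hilbert_pluckerIdeal_general_fibre (L : Fin 6 → MvPolynomial (Fin (n + 1)) K)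
    (hLh : ∀ i, (L i).IsHomogeneous 1) (u : K) {r : ℕ}
    (y : Fin (r + 1) → MvPolynomial (Fin (n + 1)) K) (hy : ∀ j, (y j).IsHomogeneous 1)
    (hr : T.card + (r + 1) + 2 = n)
    (h₁ : (finrank K (homogeneousSubmodule (Fin (n + 1)) K 1) -
      finrank K (idealDegree (pluckerIdeal (X i₀) (X i₁) (X i₂) (X i₃) (L 0) (L 1) (L 2) (L 3) (L 4) (L 5) (C u) ⊔
      Ideal.span (X '' (T : Set (Fin (n + 1)))) ⊔ Ideal.span (Set.range y)) 1)) ≤ 3)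
    (h₂ : (finrank K (homogeneousSubmodule (Fin (n + 1)) K 2) -
      finrank K (idealDegree (pluckerIdeal (X i₀) (X i₁) (X i₂) (X i₃) (L 0) (L 1) (L 2) (L 3) (L 4) (L 5) (C u) ⊔
      Ideal.span (X '' (T : Set (Fin (n + 1)))) ⊔ Ideal.span (Set.range y)) 2)) ≤ 1)
    (h₃ : ∀ f : MvPolynomial (Fin (n + 1)) K, f.IsHomogeneous 3 →
      f ∈ pluckerIdeal (X i₀) (X i₁) (X i₂) (X i₃) (L 0) (L 1) (L 2) (L 3) (L 4) (L 5) (C u) ⊔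
        Ideal.span (X '' (T : Set (Fin (n + 1)))) ⊔ Ideal.span (Set.range y)) :
    ∃ δ : MvPolynomial (Option (Fin 6 × Fin (n + 1))) K,
      eval (fun o : Option (Fin 6 × Fin (n + 1)) =>
        o.elim u fun iv => coeff (Finsupp.single iv.2 1) (L iv.1)) δ ≠ 0 ∧
      ∀ c : Option (Fin 6 × Fin (n + 1)) → K, eval c δ ≠ 0 → ∀ m : ℕ,
        (((finrank K (homogeneousSubmodule (Fin (n + 1)) K m) - finrank K (idealDegree (pluckerIdeal (X i₀) (X i₁) (X i₂) (X i₃)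
            (linForm fun v => c (some (0, v))) (linForm fun v => c (some (1, v)))
            (linForm fun v => c (some (2, v))) (linForm fun v => c (some (3, v)))
            (linForm fun v => c (some (4, v))) (linForm fun v => c (some (5, v))) (C (c none)) ⊔
          Ideal.span (X '' (T : Set (Fin (n + 1))))) m) : ℕ) : ℤ)) =
          chi (r + 1) m + 3 * chi (r + 1) ((m : ℤ) - 1) + chi (r + 1) ((m : ℤ) - 2) := by
  classical
  -- the universal data over `A = K[a_(i,v), u]`
  let LU : Fin 6 → MvPolynomial (Fin (n + 1)) (MvPolynomial (Option (Fin 6 × Fin (n + 1))) K) :=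
    fun i => ∑ v : Fin (n + 1), C (X (some (i, v)) : MvPolynomial (Option (Fin 6 × Fin (n + 1))) K) * X v
  let gP : Fin 5 → MvPolynomial (Fin (n + 1)) (MvPolynomial (Option (Fin 6 × Fin (n + 1))) K) :=
    ![plucker₁ (X i₀) (X i₁) (LU 4) (X i₂) (-(LU 2)) (LU 0), plucker₂ (X i₀) (X i₁) (LU 5) (X i₂) (-(LU 3)) (LU 1),
      plucker₃ (X i₀) (LU 4) (LU 5) (-(LU 2)) (-(LU 3)) (C (X none) * X i₃),
      plucker₄ (X i₁) (LU 4) (LU 5) (LU 0) (LU 1) (C (X none) * X i₃),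
      plucker₅ (X i₂) (-(LU 2)) (-(LU 3)) (LU 0) (LU 1) (C (X none) * X i₃)]
  let gT : ↥T → MvPolynomial (Fin (n + 1)) (MvPolynomial (Option (Fin 6 × Fin (n + 1))) K) := fun v => X (v : Fin (n + 1))
  let gY : Fin (r + 1) → MvPolynomial (Fin (n + 1)) (MvPolynomial (Option (Fin 6 × Fin (n + 1))) K) :=
    fun j => MvPolynomial.map (C : K →+* MvPolynomial (Option (Fin 6 × Fin (n + 1))) K) (y j)
  let g : Fin 5 ⊕ (↥T ⊕ Fin (r + 1)) → MvPolynomial (Fin (n + 1)) (MvPolynomial (Option (Fin 6 × Fin (n + 1))) K) :=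
    Sum.elim gP (Sum.elim gT gY)
  let e : Fin 5 ⊕ (↥T ⊕ Fin (r + 1)) → ℕ := Sum.elim (fun _ => 2) (Sum.elim (fun _ => 1) (fun _ => 1))
  have hg : ∀ j, (g j).IsHomogeneous (e j) := by
    rintro (j | (v | j))
    · exact isHomogeneous_plucker_vec (X i₀) (X i₁) (X i₂) (X i₃) (LU 0) (LU 1) (LU 2) (LU 3) (LU 4) (LU 5)
        (C (X none)) (isHomogeneous_X _ i₀) (isHomogeneous_X _ i₁) (isHomogeneous_X _ i₂)
        (isHomogeneous_C_mul_X' _ i₃) (isHomogeneous_univLinForm 0) (isHomogeneous_univLinForm 1)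
        (isHomogeneous_univLinForm 2) (isHomogeneous_univLinForm 3) (isHomogeneous_univLinForm 4)
        (isHomogeneous_univLinForm 5) j
    · exact isHomogeneous_X _ _
    · exact (hy j).map _
  -- the specialised ideal at a coefficient table `c`
  have hspec : ∀ c : Option (Fin 6 × Fin (n + 1)) → K,
      Ideal.span (Set.range fun j => MvPolynomial.map (eval c) (g j)) =
        pluckerIdeal (X i₀) (X i₁) (X i₂) (X i₃)
            (linForm fun v => c (some (0, v))) (linForm fun v => c (some (1, v)))
            (linForm fun v => c (some (2, v))) (linForm fun v => c (some (3, v)))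
            (linForm fun v => c (some (4, v))) (linForm fun v => c (some (5, v))) (C (c none)) ⊔
          Ideal.span (X '' (T : Set (Fin (n + 1)))) ⊔ Ideal.span (Set.range y) := by
    intro c
    have hLU : ∀ i, MvPolynomial.map (eval c) (LU i) = linForm fun v => c (some (i, v)) :=
      fun i => map_eval_univLinForm c i
    have hfun : (fun j => MvPolynomial.map (eval c) (g j)) =
        Sum.elim (MvPolynomial.map (eval c) ∘ gP) (Sum.elim (MvPolynomial.map (eval c) ∘ gT)
          (MvPolynomial.map (eval c) ∘ gY)) := by
      change MvPolynomial.map (eval c) ∘ Sum.elim gP (Sum.elim gT gY) = _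
      rw [Sum.comp_elim, Sum.comp_elim]
    have hP5 : Ideal.span (Set.range (MvPolynomial.map (eval c) ∘ gP)) =
        pluckerIdeal (X i₀) (X i₁) (X i₂) (X i₃)
            (linForm fun v => c (some (0, v))) (linForm fun v => c (some (1, v)))
            (linForm fun v => c (some (2, v))) (linForm fun v => c (some (3, v)))
            (linForm fun v => c (some (4, v))) (linForm fun v => c (some (5, v))) (C (c none)) := by
      rw [Set.range_comp, ← Ideal.map_span, show gP = _ from rfl, ← pluckerIdeal_eq_span_range, map_pluckerIdeal]
      simp only [map_X, map_C, eval_X, hLU]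
    have hPT : Set.range (MvPolynomial.map (eval c) ∘ gT) = X '' (T : Set (Fin (n + 1))) := by
      rw [Set.image_eq_range]
      ext q
      simp [gT]
    have hPY : Set.range (MvPolynomial.map (eval c) ∘ gY) = Set.range y := by
      ext q
      simp [gY, map_eval_map_C]
    rw [hfun, Set.Sum.elim_range, Set.Sum.elim_range, Ideal.span_union, Ideal.span_union, ← sup_assoc, hP5, hPT,
      hPY]
  -- the witness table
  have hL0 : ∀ i : Fin 6, (linForm fun v => coeff (Finsupp.single v 1) (L i)) = L i := fun i =>
    linForm_coeff_eq (hLh i)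
  -- semicontinuity in degrees 1, 2, 3
  obtain ⟨δ, hδ₀, hδ⟩ := exists_eval_ne_zero_finrank_idealDegree_le_finset g e hg
    (fun o : Option (Fin 6 × Fin (n + 1)) => o.elim u fun iv => coeff (Finsupp.single iv.2 1) (L iv.1))
    {1, 2, 3}
  -- the specialised ideal at the witness table is the witness ideal
  have hspec0 : Ideal.span (Set.range fun j => MvPolynomial.map (eval (fun o : Option (Fin 6 × Fin (n + 1)) =>
        o.elim u fun iv => coeff (Finsupp.single iv.2 1) (L iv.1))) (g j)) =
      pluckerIdeal (X i₀) (X i₁) (X i₂) (X i₃) (L 0) (L 1) (L 2) (L 3) (L 4) (L 5) (C u) ⊔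
        Ideal.span (X '' (T : Set (Fin (n + 1)))) ⊔ Ideal.span (Set.range y) := by
    rw [hspec]
    simp only [Option.elim]
    rw [hL0 0, hL0 1, hL0 2, hL0 3, hL0 4, hL0 5]
  refine ⟨δ, hδ₀, fun c hc m => ?_⟩
  have hmono := hδ c hc
  rw [hspec0, hspec c] at hmono
  have hm1 := hmono 1 (by simp)
  have hm2 := hmono 2 (by simp)
  have hm3 := hmono 3 (by simp)
  -- the reduction hypothesis at `c`
  have hL : ∀ s, (plueckerSubst (n := n) i₀ i₁ i₂ i₃
      (linForm fun v => c (some (0, v))) (linForm fun v => c (some (1, v)))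
      (linForm fun v => c (some (2, v))) (linForm fun v => c (some (3, v)))
      (linForm fun v => c (some (4, v))) (linForm fun v => c (some (5, v))) (c none) s).IsHomogeneous 1 :=
    plueckerSubst_isHomogeneous i₀ i₁ i₂ i₃ (c none) (isHomogeneous_linForm' _) (isHomogeneous_linForm' _)
      (isHomogeneous_linForm' _) (isHomogeneous_linForm' _) (isHomogeneous_linForm' _) (isHomogeneous_linForm' _)
  exact hilbert_pluckerIdeal_of_reduction T i₀ i₁ i₂ i₃ _ _ _ _ _ _ (c none) hL y hy hr
    (le_trans (Nat.sub_le_sub_left hm1 _) h₁) (le_trans (Nat.sub_le_sub_left hm2 _) h₂)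
    (forall_mem_of_finrank_le h₃ hm3) m

open Literature.AlgebraicGeometry.Kloosterman2023 in
/-- **Prop. 6.4, general linear forms — stated on the forms themselves**: with `δ` as in
`hilbert_pluckerIdeal_general_fibre` (non-zero at the coefficient table of the witness `(L⁰, u⁰)`), every sextuple of
linear forms `L'` and scalar `u'` whose coefficient table avoids `δ = 0` gives `I^{(t)}(L', u') + (x_T)` the Hilbert
function `χ_{r+1}(m) + 3χ_{r+1}(m−1) + χ_{r+1}(m−2)`. [cite: Kloosterman2025, Prop. 6.4 (proof)] -/
theorem hilbert_pluckerIdeal_general_fibre_forms (L : Fin 6 → MvPolynomial (Fin (n + 1)) K)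
    (hLh : ∀ i, (L i).IsHomogeneous 1) (u : K) {r : ℕ}
    (y : Fin (r + 1) → MvPolynomial (Fin (n + 1)) K) (hy : ∀ j, (y j).IsHomogeneous 1)
    (hr : T.card + (r + 1) + 2 = n)
    (h₁ : (finrank K (homogeneousSubmodule (Fin (n + 1)) K 1) -
      finrank K (idealDegree (pluckerIdeal (X i₀) (X i₁) (X i₂) (X i₃) (L 0) (L 1) (L 2) (L 3) (L 4) (L 5) (C u) ⊔
      Ideal.span (X '' (T : Set (Fin (n + 1)))) ⊔ Ideal.span (Set.range y)) 1)) ≤ 3)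
    (h₂ : (finrank K (homogeneousSubmodule (Fin (n + 1)) K 2) -
      finrank K (idealDegree (pluckerIdeal (X i₀) (X i₁) (X i₂) (X i₃) (L 0) (L 1) (L 2) (L 3) (L 4) (L 5) (C u) ⊔
      Ideal.span (X '' (T : Set (Fin (n + 1)))) ⊔ Ideal.span (Set.range y)) 2)) ≤ 1)
    (h₃ : ∀ f : MvPolynomial (Fin (n + 1)) K, f.IsHomogeneous 3 →
      f ∈ pluckerIdeal (X i₀) (X i₁) (X i₂) (X i₃) (L 0) (L 1) (L 2) (L 3) (L 4) (L 5) (C u) ⊔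
        Ideal.span (X '' (T : Set (Fin (n + 1)))) ⊔ Ideal.span (Set.range y)) :
    ∃ δ : MvPolynomial (Option (Fin 6 × Fin (n + 1))) K,
      eval (fun o : Option (Fin 6 × Fin (n + 1)) =>
        o.elim u fun iv => coeff (Finsupp.single iv.2 1) (L iv.1)) δ ≠ 0 ∧
      ∀ (L' : Fin 6 → MvPolynomial (Fin (n + 1)) K), (∀ i, (L' i).IsHomogeneous 1) → ∀ u' : K,
        eval (fun o : Option (Fin 6 × Fin (n + 1)) =>
          o.elim u' fun iv => coeff (Finsupp.single iv.2 1) (L' iv.1)) δ ≠ 0 → ∀ m : ℕ,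
        (((finrank K (homogeneousSubmodule (Fin (n + 1)) K m) -
          finrank K (idealDegree (pluckerIdeal (X i₀) (X i₁) (X i₂) (X i₃) (L' 0) (L' 1) (L' 2) (L' 3) (L' 4) (L' 5) (C u') ⊔
          Ideal.span (X '' (T : Set (Fin (n + 1))))) m) : ℕ) : ℤ)) =
          chi (r + 1) m + 3 * chi (r + 1) ((m : ℤ) - 1) + chi (r + 1) ((m : ℤ) - 2) := by
  obtain ⟨δ, hδ₀, hδ⟩ := hilbert_pluckerIdeal_general_fibre T i₀ i₁ i₂ i₃ L hLh u y hy hr h₁ h₂ h₃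
  refine ⟨δ, hδ₀, fun L' hL' u' hc m => ?_⟩
  have h := hδ _ hc m
  have hI : pluckerIdeal (X i₀) (X i₁) (X i₂) (X i₃)
        (linForm fun v => (fun o : Option (Fin 6 × Fin (n + 1)) =>
          o.elim u' fun iv => coeff (Finsupp.single iv.2 1) (L' iv.1)) (some (0, v)))
        (linForm fun v => (fun o : Option (Fin 6 × Fin (n + 1)) =>
          o.elim u' fun iv => coeff (Finsupp.single iv.2 1) (L' iv.1)) (some (1, v)))
        (linForm fun v => (fun o : Option (Fin 6 × Fin (n + 1)) =>
          o.elim u' fun iv => coeff (Finsupp.single iv.2 1) (L' iv.1)) (some (2, v)))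
        (linForm fun v => (fun o : Option (Fin 6 × Fin (n + 1)) =>
          o.elim u' fun iv => coeff (Finsupp.single iv.2 1) (L' iv.1)) (some (3, v)))
        (linForm fun v => (fun o : Option (Fin 6 × Fin (n + 1)) =>
          o.elim u' fun iv => coeff (Finsupp.single iv.2 1) (L' iv.1)) (some (4, v)))
        (linForm fun v => (fun o : Option (Fin 6 × Fin (n + 1)) =>
          o.elim u' fun iv => coeff (Finsupp.single iv.2 1) (L' iv.1)) (some (5, v)))
        (C ((fun o : Option (Fin 6 × Fin (n + 1)) =>
          o.elim u' fun iv => coeff (Finsupp.single iv.2 1) (L' iv.1)) none)) ⊔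
        Ideal.span (X '' (T : Set (Fin (n + 1)))) =
      pluckerIdeal (X i₀) (X i₁) (X i₂) (X i₃) (L' 0) (L' 1) (L' 2) (L' 3) (L' 4) (L' 5) (C u') ⊔
        Ideal.span (X '' (T : Set (Fin (n + 1)))) := by
    simp only [Option.elim]
    rw [linForm_coeff_eq (hL' 0), linForm_coeff_eq (hL' 1), linForm_coeff_eq (hL' 2), linForm_coeff_eq (hL' 3),
      linForm_coeff_eq (hL' 4), linForm_coeff_eq (hL' 5)]
  rw [hI] at h
  exact h

end Prop64General

/-! ## Remark 6.7: general linear forms -/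

section Rem67General

variable {n : ℕ}

/-- The range of a `Fin 6`-family given by a vector literal. [folklore] -/
private theorem range_six {R : Type*} (a₁ a₂ a₃ a₄ a₅ a₆ : R) :
    Set.range ![a₁, a₂, a₃, a₄, a₅, a₆] = {a₁, a₂, a₃, a₄, a₅, a₆} := by
  rw [Matrix.range_cons, Matrix.range_cons, Matrix.range_cons, Matrix.range_cons, Matrix.range_cons,
    Matrix.range_cons, Matrix.range_empty, Set.union_empty]
  simp only [Set.singleton_union]

variable (T : Finset (Fin (n + 1))) (i₀ i₁ i₃ i₄ : Fin (n + 1))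

open Literature.AlgebraicGeometry.Kloosterman2023 in
/-- **Remark 6.7, general linear forms (abstract coordinates).** If the Artinian reduction — `H(S/C)(1) ≤ 3`,
`C ⊇ S₂` for `C = I_t(L⁰, t⁰) + (x_T) + (y)` — holds for ONE choice of linear forms `L⁰ = (L⁰₀₅, L⁰₁₅, L⁰₂₃, L⁰₂₄)`,
scalar `t⁰` and linear `y` (`#T + (r+1) + 2 = n`), then some polynomial `δ` in the coefficient table of `(L, t)`,
non-zero at `(L⁰, t⁰)`, has: `δ(a, t) ≠ 0 ⟹` the ideal of `2 × 2` minors of `A_t(L)` plus `(x_T)` has Hilbert function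
`χ_{r+1}(m) + 3χ_{r+1}(m−1)` (lower semicontinuity of `dim_K C_d`, `d = 1, 2`
[cite: GortzWedhorn2020, (16.1), eq. (16.1.1)], then the tree's `hilbert_scrollFibreIdeal_of_reduction`).
[cite: Kloosterman2025, Remark 6.7] -/
theorem hilbert_scrollFibreIdeal_general_fibre (L : Fin 4 → MvPolynomial (Fin (n + 1)) K)
    (hLh : ∀ i, (L i).IsHomogeneous 1) (t : K) {r : ℕ}
    (y : Fin (r + 1) → MvPolynomial (Fin (n + 1)) K) (hy : ∀ j, (y j).IsHomogeneous 1)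
    (hr : T.card + (r + 1) + 2 = n)
    (h₁ : (finrank K (homogeneousSubmodule (Fin (n + 1)) K 1) -
      finrank K (idealDegree (scrollFibreIdeal T i₀ i₁ i₃ i₄ (L 0) (L 1) (L 2) (L 3) t ⊔ Ideal.span (Set.range y)) 1)) ≤ 3)
    (h₂ : ∀ f : MvPolynomial (Fin (n + 1)) K, f.IsHomogeneous 2 →
      f ∈ scrollFibreIdeal T i₀ i₁ i₃ i₄ (L 0) (L 1) (L 2) (L 3) t ⊔ Ideal.span (Set.range y)) :
    ∃ δ : MvPolynomial (Option (Fin 4 × Fin (n + 1))) K,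
      eval (fun o : Option (Fin 4 × Fin (n + 1)) =>
        o.elim t fun iv => coeff (Finsupp.single iv.2 1) (L iv.1)) δ ≠ 0 ∧
      ∀ c : Option (Fin 4 × Fin (n + 1)) → K, eval c δ ≠ 0 → ∀ m : ℕ,
        (((finrank K (homogeneousSubmodule (Fin (n + 1)) K m) - finrank K (idealDegree (scrollFibreIdeal T i₀ i₁ i₃ i₄
            (linForm fun v => c (some (0, v))) (linForm fun v => c (some (1, v)))
            (linForm fun v => c (some (2, v))) (linForm fun v => c (some (3, v))) (c none)) m) : ℕ) : ℤ)) =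
          chi (r + 1) m + 3 * chi (r + 1) ((m : ℤ) - 1) := by
  classical
  -- the universal data over `A = K[a_(i,v), t]`
  let LU : Fin 4 → MvPolynomial (Fin (n + 1)) (MvPolynomial (Option (Fin 4 × Fin (n + 1))) K) :=
    fun i => ∑ v : Fin (n + 1), C (X (some (i, v)) : MvPolynomial (Option (Fin 4 × Fin (n + 1))) K) * X v
  let tU : MvPolynomial (Fin (n + 1)) (MvPolynomial (Option (Fin 4 × Fin (n + 1))) K) := C (X none)
  let gS : Fin 6 → MvPolynomial (Fin (n + 1)) (MvPolynomial (Option (Fin 4 × Fin (n + 1))) K) :=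
    ![X i₀ * X i₃ - tU * LU 3 * LU 1, X i₀ * X i₄ + tU * LU 1 * LU 2, X i₁ * X i₃ + tU * LU 3 * LU 0,
      X i₁ * X i₄ - tU * LU 0 * LU 2, X i₀ * LU 0 + X i₁ * LU 1, tU * (X i₃ * LU 2 + X i₄ * LU 3)]
  let gT : ↥T → MvPolynomial (Fin (n + 1)) (MvPolynomial (Option (Fin 4 × Fin (n + 1))) K) :=
    fun v => X (v : Fin (n + 1))
  let gY : Fin (r + 1) → MvPolynomial (Fin (n + 1)) (MvPolynomial (Option (Fin 4 × Fin (n + 1))) K) :=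
    fun j => MvPolynomial.map (C : K →+* MvPolynomial (Option (Fin 4 × Fin (n + 1))) K) (y j)
  let g : Fin 6 ⊕ (↥T ⊕ Fin (r + 1)) → MvPolynomial (Fin (n + 1)) (MvPolynomial (Option (Fin 4 × Fin (n + 1))) K) :=
    Sum.elim gS (Sum.elim gT gY)
  let e : Fin 6 ⊕ (↥T ⊕ Fin (r + 1)) → ℕ := Sum.elim (fun _ => 2) (Sum.elim (fun _ => 1) (fun _ => 1))
  have hLU1 : ∀ i, (LU i).IsHomogeneous 1 := fun i => isHomogeneous_univLinForm i
  have hX1 : ∀ l : Fin (n + 1),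
      (X l : MvPolynomial (Fin (n + 1)) (MvPolynomial (Option (Fin 4 × Fin (n + 1))) K)).IsHomogeneous 1 :=
    fun l => isHomogeneous_X _ l
  have hg : ∀ j, (g j).IsHomogeneous (e j) := by
    rintro (j | (v | j))
    · change (gS j).IsHomogeneous 2
      fin_cases j
      · exact ((hX1 i₀).mul (hX1 i₃)).sub (((hLU1 3).C_mul _).mul (hLU1 1))
      · exact ((hX1 i₀).mul (hX1 i₄)).add (((hLU1 1).C_mul _).mul (hLU1 2))
      · exact ((hX1 i₁).mul (hX1 i₃)).add (((hLU1 3).C_mul _).mul (hLU1 0))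
      · exact ((hX1 i₁).mul (hX1 i₄)).sub (((hLU1 0).C_mul _).mul (hLU1 2))
      · exact ((hX1 i₀).mul (hLU1 0)).add ((hX1 i₁).mul (hLU1 1))
      · exact (((hX1 i₃).mul (hLU1 2)).add ((hX1 i₄).mul (hLU1 3))).C_mul _
    · exact isHomogeneous_X _ _
    · exact (hy j).map _
  -- the specialised ideal at a coefficient table `c`
  have hspec : ∀ c : Option (Fin 4 × Fin (n + 1)) → K,
      Ideal.span (Set.range fun j => MvPolynomial.map (eval c) (g j)) =
        scrollFibreIdeal T i₀ i₁ i₃ i₄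
            (linForm fun v => c (some (0, v))) (linForm fun v => c (some (1, v)))
            (linForm fun v => c (some (2, v))) (linForm fun v => c (some (3, v))) (c none) ⊔
          Ideal.span (Set.range y) := by
    intro c
    have hLU : ∀ i, MvPolynomial.map (eval c) (LU i) = linForm fun v => c (some (i, v)) :=
      fun i => map_eval_univLinForm c i
    have htU : MvPolynomial.map (eval c) tU = C (c none) := by
      simp only [tU, map_C, eval_X]
    have hfun : (fun j => MvPolynomial.map (eval c) (g j)) =
        Sum.elim (MvPolynomial.map (eval c) ∘ gS) (Sum.elim (MvPolynomial.map (eval c) ∘ gT)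
          (MvPolynomial.map (eval c) ∘ gY)) := by
      change MvPolynomial.map (eval c) ∘ Sum.elim gS (Sum.elim gT gY) = _
      rw [Sum.comp_elim, Sum.comp_elim]
    have hS6 : Ideal.span (Set.range (MvPolynomial.map (eval c) ∘ gS)) =
        Ideal.span {X i₀ * X i₃ - C (c none) * (linForm fun v => c (some (3, v))) * (linForm fun v => c (some (1, v))),
          X i₀ * X i₄ + C (c none) * (linForm fun v => c (some (1, v))) * (linForm fun v => c (some (2, v))),
          X i₁ * X i₃ + C (c none) * (linForm fun v => c (some (3, v))) * (linForm fun v => c (some (0, v))),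
          X i₁ * X i₄ - C (c none) * (linForm fun v => c (some (0, v))) * (linForm fun v => c (some (2, v))),
          X i₀ * (linForm fun v => c (some (0, v))) + X i₁ * (linForm fun v => c (some (1, v))),
          C (c none) * (X i₃ * (linForm fun v => c (some (2, v))) + X i₄ * (linForm fun v => c (some (3, v))))} := by
      rw [Set.range_comp, show Set.range gS = _ from range_six _ _ _ _ _ _]
      simp only [Set.image_insert_eq, Set.image_singleton, map_sub, map_add, map_mul, map_X, hLU, htU]
    have hPT : Set.range (MvPolynomial.map (eval c) ∘ gT) = X '' (T : Set (Fin (n + 1))) := by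
      rw [Set.image_eq_range]
      ext q
      simp [gT]
    have hPY : Set.range (MvPolynomial.map (eval c) ∘ gY) = Set.range y := by
      ext q
      simp [gY, map_eval_map_C]
    rw [hfun, Set.Sum.elim_range, Set.Sum.elim_range, Ideal.span_union, Ideal.span_union, ← sup_assoc, hS6, hPT,
      hPY, scrollFibreIdeal_eq_span]
  -- the witness table
  have hL0 : ∀ i : Fin 4, (linForm fun v => coeff (Finsupp.single v 1) (L i)) = L i := fun i =>
    linForm_coeff_eq (hLh i)
  -- semicontinuity in degrees 1, 2
  obtain ⟨δ, hδ₀, hδ⟩ := exists_eval_ne_zero_finrank_idealDegree_le_finset g e hg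
    (fun o : Option (Fin 4 × Fin (n + 1)) => o.elim t fun iv => coeff (Finsupp.single iv.2 1) (L iv.1))
    {1, 2}
  have hspec0 : Ideal.span (Set.range fun j => MvPolynomial.map (eval (fun o : Option (Fin 4 × Fin (n + 1)) =>
        o.elim t fun iv => coeff (Finsupp.single iv.2 1) (L iv.1))) (g j)) =
      scrollFibreIdeal T i₀ i₁ i₃ i₄ (L 0) (L 1) (L 2) (L 3) t ⊔ Ideal.span (Set.range y) := by
    rw [hspec]
    simp only [Option.elim]
    rw [hL0 0, hL0 1, hL0 2, hL0 3]
  refine ⟨δ, hδ₀, fun c hc m => ?_⟩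
  have hmono := hδ c hc
  rw [hspec0, hspec c] at hmono
  have hm1 := hmono 1 (by simp)
  have hm2 := hmono 2 (by simp)
  have hL : ∀ s, (scrollSubst (n := n) i₀ i₁ i₃ i₄
      (linForm fun v => c (some (0, v))) (linForm fun v => c (some (1, v)))
      (linForm fun v => c (some (2, v))) (linForm fun v => c (some (3, v))) (c none) s).IsHomogeneous 1 :=
    scrollSubst_isHomogeneous i₀ i₁ i₃ i₄ (c none) (isHomogeneous_linForm' _) (isHomogeneous_linForm' _)
      (isHomogeneous_linForm' _) (isHomogeneous_linForm' _)
  exact hilbert_scrollFibreIdeal_of_reduction T i₀ i₁ i₃ i₄ _ _ _ _ (c none) hL y hy hr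
    (le_trans (Nat.sub_le_sub_left hm1 _) h₁) (forall_mem_of_finrank_le h₂ hm2) m

open Literature.AlgebraicGeometry.Kloosterman2023 in
/-- **Remark 6.7, general linear forms — stated on the forms themselves** (as `hilbert_scrollFibreIdeal_general_fibre`,
evaluated at the coefficient table of arbitrary linear `L'` and scalar `t'`). [cite: Kloosterman2025, Remark 6.7] -/
theorem hilbert_scrollFibreIdeal_general_fibre_forms (L : Fin 4 → MvPolynomial (Fin (n + 1)) K)
    (hLh : ∀ i, (L i).IsHomogeneous 1) (t : K) {r : ℕ}
    (y : Fin (r + 1) → MvPolynomial (Fin (n + 1)) K) (hy : ∀ j, (y j).IsHomogeneous 1)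
    (hr : T.card + (r + 1) + 2 = n)
    (h₁ : (finrank K (homogeneousSubmodule (Fin (n + 1)) K 1) -
      finrank K (idealDegree (scrollFibreIdeal T i₀ i₁ i₃ i₄ (L 0) (L 1) (L 2) (L 3) t ⊔ Ideal.span (Set.range y)) 1)) ≤ 3)
    (h₂ : ∀ f : MvPolynomial (Fin (n + 1)) K, f.IsHomogeneous 2 →
      f ∈ scrollFibreIdeal T i₀ i₁ i₃ i₄ (L 0) (L 1) (L 2) (L 3) t ⊔ Ideal.span (Set.range y)) :
    ∃ δ : MvPolynomial (Option (Fin 4 × Fin (n + 1))) K,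
      eval (fun o : Option (Fin 4 × Fin (n + 1)) =>
        o.elim t fun iv => coeff (Finsupp.single iv.2 1) (L iv.1)) δ ≠ 0 ∧
      ∀ (L' : Fin 4 → MvPolynomial (Fin (n + 1)) K), (∀ i, (L' i).IsHomogeneous 1) → ∀ t' : K,
        eval (fun o : Option (Fin 4 × Fin (n + 1)) =>
          o.elim t' fun iv => coeff (Finsupp.single iv.2 1) (L' iv.1)) δ ≠ 0 → ∀ m : ℕ,
        (((finrank K (homogeneousSubmodule (Fin (n + 1)) K m) -
          finrank K (idealDegree (scrollFibreIdeal T i₀ i₁ i₃ i₄ (L' 0) (L' 1) (L' 2) (L' 3) t') m) : ℕ) : ℤ)) =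
          chi (r + 1) m + 3 * chi (r + 1) ((m : ℤ) - 1) := by
  obtain ⟨δ, hδ₀, hδ⟩ := hilbert_scrollFibreIdeal_general_fibre T i₀ i₁ i₃ i₄ L hLh t y hy hr h₁ h₂
  refine ⟨δ, hδ₀, fun L' hL' t' hc m => ?_⟩
  have h := hδ _ hc m
  have hI : scrollFibreIdeal T i₀ i₁ i₃ i₄
        (linForm fun v => (fun o : Option (Fin 4 × Fin (n + 1)) =>
          o.elim t' fun iv => coeff (Finsupp.single iv.2 1) (L' iv.1)) (some (0, v)))
        (linForm fun v => (fun o : Option (Fin 4 × Fin (n + 1)) =>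
          o.elim t' fun iv => coeff (Finsupp.single iv.2 1) (L' iv.1)) (some (1, v)))
        (linForm fun v => (fun o : Option (Fin 4 × Fin (n + 1)) =>
          o.elim t' fun iv => coeff (Finsupp.single iv.2 1) (L' iv.1)) (some (2, v)))
        (linForm fun v => (fun o : Option (Fin 4 × Fin (n + 1)) =>
          o.elim t' fun iv => coeff (Finsupp.single iv.2 1) (L' iv.1)) (some (3, v)))
        ((fun o : Option (Fin 4 × Fin (n + 1)) =>
          o.elim t' fun iv => coeff (Finsupp.single iv.2 1) (L' iv.1)) none) =
      scrollFibreIdeal T i₀ i₁ i₃ i₄ (L' 0) (L' 1) (L' 2) (L' 3) t' := by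
    simp only [Option.elim]
    rw [linForm_coeff_eq (hL' 0), linForm_coeff_eq (hL' 1), linForm_coeff_eq (hL' 2), linForm_coeff_eq (hL' 3)]
  rw [hI] at h
  exact h

end Rem67General

/-! ## The printed coordinates: `k = 2, 3, 4` -/

section Printed

open Literature.AlgebraicGeometry.Kloosterman2023 in
/-- **Prop. 6.4 for `k = 2` (cubic fourfolds with two disjoint planes, cell `(4,3,−1)`), GENERAL linear forms**: there is a non-zero polynomial `δ` in the
`6·6 + 1` coefficients of `(L₀₄, L₀₅, L₁₄, L₁₅, L₂₄, L₂₅, u)` such that for every cubic `2k`-fold datum with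
`δ ≠ 0` the ideal `I^{(t)} + (x_{k+4}, …, x_{2k+1})` of the five substituted Plücker quadrics has Hilbert function
`χ_{3}(m) + 3χ_{3}(m−1) + χ_{3}(m−2)` — the Hilbert function of the central fibre `I^{(0)}`
(`prop_6_4_hilbert_limit`): "the Hilbert functions of `I^{(0)}` and of `I^{(t)}` coincide" for the general member.
Witness: the rational instance `prop_6_4_reduction_cubicFourfold_instance`. [cite: Kloosterman2025, Prop. 6.4 (proof)] -/
theorem prop_6_4_hilbert_general_fibre_k2 :
    ∃ δ : MvPolynomial (Option (Fin 6 × Fin (2 * 2 + 2))) K, δ ≠ 0 ∧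
      (∃ c₀ : Option (Fin 6 × Fin (2 * 2 + 2)) → K, eval c₀ δ ≠ 0) ∧
      ∀ c : Option (Fin 6 × Fin (2 * 2 + 2)) → K, eval c δ ≠ 0 → ∀ m : ℕ,
        (((finrank K (homogeneousSubmodule (Fin (2 * 2 + 2)) K m) - finrank K (idealDegree
          (pluckerIdeal (X ⟨0, by omega⟩) (X ⟨1, by omega⟩) (X ⟨2, by omega⟩) (X ⟨3, by omega⟩)
              (linForm fun v => c (some (0, v))) (linForm fun v => c (some (1, v))) (linForm fun v => c (some (2, v)))
              (linForm fun v => c (some (3, v))) (linForm fun v => c (some (4, v))) (linForm fun v => c (some (5, v)))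
              (C (c none)) ⊔
            Ideal.span (X '' (tailVars 2 (2 + 4) : Set (Fin (2 * 2 + 2))))) m) : ℕ) : ℤ)) =
          chi 3 m + 3 * chi 3 ((m : ℤ) - 1) + chi 3 ((m : ℤ) - 2) := by
  obtain ⟨h₁, h₂, h₃⟩ := prop_6_4_reduction_cubicFourfold_instance (K := K)
  have hLh : ∀ i, ((![X 4, X 0 + X 5, X 0 + X 5, X 1 + X 4, X 1 + X 4, X 2 + X 3] : Fin 6 → MvPolynomial (Fin (2 * 2 + 2)) K) i).IsHomogeneous 1 := by
    intro i
    fin_cases i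
    · exact isHomogeneous_X K 4
    · exact (isHomogeneous_X K 0).add (isHomogeneous_X K 5)
    · exact (isHomogeneous_X K 0).add (isHomogeneous_X K 5)
    · exact (isHomogeneous_X K 1).add (isHomogeneous_X K 4)
    · exact (isHomogeneous_X K 1).add (isHomogeneous_X K 4)
    · exact (isHomogeneous_X K 2).add (isHomogeneous_X K 3)
  obtain ⟨δ, hδ₀, hδ⟩ := hilbert_pluckerIdeal_general_fibre (n := 2 * 2 + 1) (tailVars 2 (2 + 4))
    ⟨0, by omega⟩ ⟨1, by omega⟩ ⟨2, by omega⟩ ⟨3, by omega⟩ ![X 4, X 0 + X 5, X 0 + X 5, X 1 + X 4, X 1 + X 4, X 2 + X 3] hLh 1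
    (fun j : Fin (2 + 1) => X (![3, 4, 5] j)) (fun _ => isHomogeneous_X K _) (by decide) h₁ h₂ h₃
  exact ⟨δ, fun h => hδ₀ (by rw [h, map_zero]), ⟨_, hδ₀⟩, fun c hc m => hδ c hc m⟩

open Literature.AlgebraicGeometry.Kloosterman2023 in
/-- **Prop. 6.4 for `k = 3` (cubic sixfolds, two 3-planes through a point, cell `(6,3,0)`), GENERAL linear forms**: there is a non-zero polynomial `δ` in the
`6·8 + 1` coefficients of `(L₀₄, L₀₅, L₁₄, L₁₅, L₂₄, L₂₅, u)` such that for every cubic `2k`-fold datum with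
`δ ≠ 0` the ideal `I^{(t)} + (x_{k+4}, …, x_{2k+1})` of the five substituted Plücker quadrics has Hilbert function
`χ_{4}(m) + 3χ_{4}(m−1) + χ_{4}(m−2)` — the Hilbert function of the central fibre `I^{(0)}`
(`prop_6_4_hilbert_limit`): "the Hilbert functions of `I^{(0)}` and of `I^{(t)}` coincide" for the general member.
Witness: the rational instance `prop_6_4_reduction_instance_k3`. [cite: Kloosterman2025, Prop. 6.4 (proof)] -/
theorem prop_6_4_hilbert_general_fibre_k3 :
    ∃ δ : MvPolynomial (Option (Fin 6 × Fin (2 * 3 + 2))) K, δ ≠ 0 ∧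
      (∃ c₀ : Option (Fin 6 × Fin (2 * 3 + 2)) → K, eval c₀ δ ≠ 0) ∧
      ∀ c : Option (Fin 6 × Fin (2 * 3 + 2)) → K, eval c δ ≠ 0 → ∀ m : ℕ,
        (((finrank K (homogeneousSubmodule (Fin (2 * 3 + 2)) K m) - finrank K (idealDegree
          (pluckerIdeal (X ⟨0, by omega⟩) (X ⟨1, by omega⟩) (X ⟨2, by omega⟩) (X ⟨3, by omega⟩)
              (linForm fun v => c (some (0, v))) (linForm fun v => c (some (1, v))) (linForm fun v => c (some (2, v)))
              (linForm fun v => c (some (3, v))) (linForm fun v => c (some (4, v))) (linForm fun v => c (some (5, v)))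
              (C (c none)) ⊔
            Ideal.span (X '' (tailVars 3 (3 + 4) : Set (Fin (2 * 3 + 2))))) m) : ℕ) : ℤ)) =
          chi 4 m + 3 * chi 4 ((m : ℤ) - 1) + chi 4 ((m : ℤ) - 2) := by
  obtain ⟨h₁, h₂, h₃⟩ := prop_6_4_reduction_instance_k3 (K := K)
  have hLh : ∀ i, ((![-(X 0), X 0 - (X 4), -(X 1) + X 5, -(X 2) + X 4, X 2 + X 4, -(X 3)] : Fin 6 → MvPolynomial (Fin (2 * 3 + 2)) K) i).IsHomogeneous 1 := by
    intro i
    fin_cases i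
    · exact (isHomogeneous_X K 0).neg
    · exact (isHomogeneous_X K 0).sub (isHomogeneous_X K 4)
    · exact (isHomogeneous_X K 1).neg.add (isHomogeneous_X K 5)
    · exact (isHomogeneous_X K 2).neg.add (isHomogeneous_X K 4)
    · exact (isHomogeneous_X K 2).add (isHomogeneous_X K 4)
    · exact (isHomogeneous_X K 3).neg
  obtain ⟨δ, hδ₀, hδ⟩ := hilbert_pluckerIdeal_general_fibre (n := 2 * 3 + 1) (tailVars 3 (3 + 4))
    ⟨0, by omega⟩ ⟨1, by omega⟩ ⟨2, by omega⟩ ⟨3, by omega⟩ ![-(X 0), X 0 - (X 4), -(X 1) + X 5, -(X 2) + X 4, X 2 + X 4, -(X 3)] hLh 1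
    (fun j : Fin (3 + 1) => X (![3, 4, 5, 6] j)) (fun _ => isHomogeneous_X K _) (by decide) h₁ h₂ h₃
  exact ⟨δ, fun h => hδ₀ (by rw [h, map_zero]), ⟨_, hδ₀⟩, fun c hc m => hδ c hc m⟩

open Literature.AlgebraicGeometry.Kloosterman2023 in
/-- **Prop. 6.4 for `k = 4` (cubic eightfolds, two 4-planes through a line, cell `(8,3,1)`), GENERAL linear forms**: there is a non-zero polynomial `δ` in the
`6·10 + 1` coefficients of `(L₀₄, L₀₅, L₁₄, L₁₅, L₂₄, L₂₅, u)` such that for every cubic `2k`-fold datum with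
`δ ≠ 0` the ideal `I^{(t)} + (x_{k+4}, …, x_{2k+1})` of the five substituted Plücker quadrics has Hilbert function
`χ_{5}(m) + 3χ_{5}(m−1) + χ_{5}(m−2)` — the Hilbert function of the central fibre `I^{(0)}`
(`prop_6_4_hilbert_limit`): "the Hilbert functions of `I^{(0)}` and of `I^{(t)}` coincide" for the general member.
Witness: the rational instance `prop_6_4_reduction_instance_k4`. [cite: Kloosterman2025, Prop. 6.4 (proof)] -/
theorem prop_6_4_hilbert_general_fibre_k4 :
    ∃ δ : MvPolynomial (Option (Fin 6 × Fin (2 * 4 + 2))) K, δ ≠ 0 ∧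
      (∃ c₀ : Option (Fin 6 × Fin (2 * 4 + 2)) → K, eval c₀ δ ≠ 0) ∧
      ∀ c : Option (Fin 6 × Fin (2 * 4 + 2)) → K, eval c δ ≠ 0 → ∀ m : ℕ,
        (((finrank K (homogeneousSubmodule (Fin (2 * 4 + 2)) K m) - finrank K (idealDegree
          (pluckerIdeal (X ⟨0, by omega⟩) (X ⟨1, by omega⟩) (X ⟨2, by omega⟩) (X ⟨3, by omega⟩)
              (linForm fun v => c (some (0, v))) (linForm fun v => c (some (1, v))) (linForm fun v => c (some (2, v)))
              (linForm fun v => c (some (3, v))) (linForm fun v => c (some (4, v))) (linForm fun v => c (some (5, v)))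
              (C (c none)) ⊔
            Ideal.span (X '' (tailVars 4 (4 + 4) : Set (Fin (2 * 4 + 2))))) m) : ℕ) : ℤ)) =
          chi 5 m + 3 * chi 5 ((m : ℤ) - 1) + chi 5 ((m : ℤ) - 2) := by
  obtain ⟨h₁, h₂, h₃⟩ := prop_6_4_reduction_instance_k4 (K := K)
  have hLh : ∀ i, ((![-(X 1) + X 2, X 1, X 6, X 2 + X 7, X 1 + X 7, X 0 - (X 6)] : Fin 6 → MvPolynomial (Fin (2 * 4 + 2)) K) i).IsHomogeneous 1 := by
    intro i
    fin_cases i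
    · exact (isHomogeneous_X K 1).neg.add (isHomogeneous_X K 2)
    · exact isHomogeneous_X K 1
    · exact isHomogeneous_X K 6
    · exact (isHomogeneous_X K 2).add (isHomogeneous_X K 7)
    · exact (isHomogeneous_X K 1).add (isHomogeneous_X K 7)
    · exact (isHomogeneous_X K 0).sub (isHomogeneous_X K 6)
  obtain ⟨δ, hδ₀, hδ⟩ := hilbert_pluckerIdeal_general_fibre (n := 2 * 4 + 1) (tailVars 4 (4 + 4))
    ⟨0, by omega⟩ ⟨1, by omega⟩ ⟨2, by omega⟩ ⟨3, by omega⟩ ![-(X 1) + X 2, X 1, X 6, X 2 + X 7, X 1 + X 7, X 0 - (X 6)] hLh 1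
    (fun j : Fin (4 + 1) => X (![0, 3, 4, 5, 7] j)) (fun _ => isHomogeneous_X K _) (by decide) h₁ h₂ h₃
  exact ⟨δ, fun h => hδ₀ (by rw [h, map_zero]), ⟨_, hδ₀⟩, fun c hc m => hδ c hc m⟩

open Literature.AlgebraicGeometry.Kloosterman2023 in
/-- **Remark 6.7 for `k = 2`, GENERAL linear forms**: there is a non-zero polynomial `δ` in the coefficients of
`(L₀₅, L₁₅, L₂₃, L₂₄, t)` such that whenever `δ ≠ 0` the ideal of `2 × 2` minors of `A_t` plus the tail has Hilbert
function `χ_{3}(m) + 3χ_{3}(m−1)` — the value of the central fibre (`remark_6_7_hilbert_limit`), a linear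
section of the cone over the quartic scroll (for `k = 2`: a quartic surface scroll in `ℙ⁵`). Witness: `remark_6_7_reduction_cubicFourfold_instance`. [cite: Kloosterman2025, Remark 6.7] -/
theorem remark_6_7_hilbert_general_fibre_k2 :
    ∃ δ : MvPolynomial (Option (Fin 4 × Fin (2 * 2 + 2))) K, δ ≠ 0 ∧
      (∃ c₀ : Option (Fin 4 × Fin (2 * 2 + 2)) → K, eval c₀ δ ≠ 0) ∧
      ∀ c : Option (Fin 4 × Fin (2 * 2 + 2)) → K, eval c δ ≠ 0 → ∀ m : ℕ,
        (((finrank K (homogeneousSubmodule (Fin (2 * 2 + 2)) K m) - finrank K (idealDegree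
          (scrollFibreIdeal (tailVars 2 (2 + 4)) ⟨0, by omega⟩ ⟨1, by omega⟩ ⟨3, by omega⟩ ⟨4, by omega⟩
              (linForm fun v => c (some (0, v))) (linForm fun v => c (some (1, v)))
              (linForm fun v => c (some (2, v))) (linForm fun v => c (some (3, v))) (c none)) m) : ℕ) : ℤ)) =
          chi 3 m + 3 * chi 3 ((m : ℤ) - 1) := by
  obtain ⟨h₁, h₂⟩ := remark_6_7_reduction_cubicFourfold_instance (K := K)
  have hLh : ∀ i, ((![X 5, X 1 + X 5, X 5, X 2 + X 4] : Fin 4 → MvPolynomial (Fin (2 * 2 + 2)) K) i).IsHomogeneous 1 := by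
    intro i
    fin_cases i
    · exact isHomogeneous_X K 5
    · exact (isHomogeneous_X K 1).add (isHomogeneous_X K 5)
    · exact isHomogeneous_X K 5
    · exact (isHomogeneous_X K 2).add (isHomogeneous_X K 4)
  obtain ⟨δ, hδ₀, hδ⟩ := hilbert_scrollFibreIdeal_general_fibre (n := 2 * 2 + 1) (tailVars 2 (2 + 4))
    ⟨0, by omega⟩ ⟨1, by omega⟩ ⟨3, by omega⟩ ⟨4, by omega⟩ ![X 5, X 1 + X 5, X 5, X 2 + X 4] hLh 1
    (fun j : Fin (2 + 1) => X (![0, 2, 3] j)) (fun _ => isHomogeneous_X K _) (by decide) h₁ h₂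
  exact ⟨δ, fun h => hδ₀ (by rw [h, map_zero]), ⟨_, hδ₀⟩, fun c hc m => hδ c hc m⟩

open Literature.AlgebraicGeometry.Kloosterman2023 in
/-- **Remark 6.7 for `k = 3`, GENERAL linear forms**: there is a non-zero polynomial `δ` in the coefficients of
`(L₀₅, L₁₅, L₂₃, L₂₄, t)` such that whenever `δ ≠ 0` the ideal of `2 × 2` minors of `A_t` plus the tail has Hilbert
function `χ_{4}(m) + 3χ_{4}(m−1)` — the value of the central fibre (`remark_6_7_hilbert_limit`), a linear
section of the cone over the quartic scroll. Witness: `remark_6_7_reduction_instance_k3`. [cite: Kloosterman2025, Remark 6.7] -/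
theorem remark_6_7_hilbert_general_fibre_k3 :
    ∃ δ : MvPolynomial (Option (Fin 4 × Fin (2 * 3 + 2))) K, δ ≠ 0 ∧
      (∃ c₀ : Option (Fin 4 × Fin (2 * 3 + 2)) → K, eval c₀ δ ≠ 0) ∧
      ∀ c : Option (Fin 4 × Fin (2 * 3 + 2)) → K, eval c δ ≠ 0 → ∀ m : ℕ,
        (((finrank K (homogeneousSubmodule (Fin (2 * 3 + 2)) K m) - finrank K (idealDegree
          (scrollFibreIdeal (tailVars 3 (3 + 4)) ⟨0, by omega⟩ ⟨1, by omega⟩ ⟨3, by omega⟩ ⟨4, by omega⟩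
              (linForm fun v => c (some (0, v))) (linForm fun v => c (some (1, v)))
              (linForm fun v => c (some (2, v))) (linForm fun v => c (some (3, v))) (c none)) m) : ℕ) : ℤ)) =
          chi 4 m + 3 * chi 4 ((m : ℤ) - 1) := by
  obtain ⟨h₁, h₂⟩ := remark_6_7_reduction_instance_k3 (K := K)
  have hLh : ∀ i, ((![X 0 + X 3, X 1 + X 3, X 6, X 0 - (X 4)] : Fin 4 → MvPolynomial (Fin (2 * 3 + 2)) K) i).IsHomogeneous 1 := by
    intro i
    fin_cases i
    · exact (isHomogeneous_X K 0).add (isHomogeneous_X K 3)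
    · exact (isHomogeneous_X K 1).add (isHomogeneous_X K 3)
    · exact isHomogeneous_X K 6
    · exact (isHomogeneous_X K 0).sub (isHomogeneous_X K 4)
  obtain ⟨δ, hδ₀, hδ⟩ := hilbert_scrollFibreIdeal_general_fibre (n := 2 * 3 + 1) (tailVars 3 (3 + 4))
    ⟨0, by omega⟩ ⟨1, by omega⟩ ⟨3, by omega⟩ ⟨4, by omega⟩ ![X 0 + X 3, X 1 + X 3, X 6, X 0 - (X 4)] hLh 1
    (fun j : Fin (3 + 1) => X (![2, 3, 5, 6] j)) (fun _ => isHomogeneous_X K _) (by decide) h₁ h₂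
  exact ⟨δ, fun h => hδ₀ (by rw [h, map_zero]), ⟨_, hδ₀⟩, fun c hc m => hδ c hc m⟩

end Printed

end Literature.AlgebraicGeometry.Kloosterman2025
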